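/-
Copyright (c) 2026 the pub-hodgecm-mathlib formalisation cell (harness21).  Prover seat hodgecm-mathlib-LH7-p04 (g13), 2026-09-03.  Line LH4 ∕ L2-3 «CM glue» of the dyadic
(D-UNR) road (census `CENSUS-L23-CM.v1.LH10p01g12.md`, fence `φ_θ` everywhere, LEAD T15-55): the 2-FREE twin «BINDERS-θ TYPE (2)» of ★ `TypeTwoCayleyShiftBindersCM` — the
σ-fixed pair `(c+1, c−1 ∣ c−1, c+1)` (which needs `|2|_w = 1`) is replaced by the HERMITIAN pair `(θ, c−θ ∣ c−σθ, σθ)` with `θ + σθ = 1`, `|θ|_w ≤ 1` (any residue characteristic).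
-/
import Literature.NumberTheory.Rogawski1990.TypeTwoCayleyShiftBindersCM        -- ★ γ₃ (pattern; §1 `separable_of_map_evalRingHom`, `map_smul_add_smul_one`, `smul_reindex_add_smul_one`, `smul_fromBlocks_add_smul_one`); brings ★ γ₂ γ₁ α β
import Literature.NumberTheory.Automorphic.TypeTwoHermitianMoebiusShiftFrame   -- ★ P3 (LH10-p01 (g12)): `valued_hermitianShift_denominators_of_unitary_of_exp`, `valued_disc/eval_charpoly_hermitianMoebius_of_exp`, `not_exists_isRoot_charpoly_genMoebius`; brings ★ P2
import Literature.NumberTheory.Automorphic.MatrixGenMoebiusShift               -- ★ (LH4-p01 (g12)) four-scalar kit: `map_genMoebius`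
import HarnessLib

/-!
# The type-(2) hermitian shift at a CM place: the denominators are units, and the shifted pair carries the ★ value theorems' binders at `(n − 2, N − 1)` — no `|2| = 1`

Topic `NumberTheory/Rogawski1990`; namespace `Literature.NumberTheory.Rogawski1990`.  THEOREMS ONLY (no definition, no instance, no notation, no named fact, no `sorry`); kernel lane
`--supports stmt-HodgeConjecture-24833`.  Cell `pub/hodgecm-mathlib`, crux H413; line LH4, organ `stub_DyUnramCore` ∕ L2-3 (the hyperspecial-interior row of the dyadic local transfer),
CM-glue road of ★ `TypeTwoHermitianShiftCM` (carriers, LH4-p01 (g12)) — this file is the θ-twin of ★ γ₃ `TypeTwoCayleyShiftBindersCM` (F0P2-p06 (g10)), token for token, with the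
hypothesis `h2 : |2|_w = 1` REPLACED by the hermitian binders `(θ : LocalRing L v) (hθ : θ + conjLocal θ = 1) (hθv : |θ_w| ≤ 1)` (convention of the road, LH4-p01 ∕ LH10-p01 (g12)) and
the pair `(c+1, c−1 ∣ c−1, c+1) ↦ (θ, c−θ ∣ c−σθ, σθ)`.  Such a `θ` exists at every non-split UNRAMIFIED `w ∣ v` (★ `UnitaryGroup.exists_conjLocal_add_self_eq_one`), dyadic or not.
HONEST LABEL: HC_CM is proved only modulo the cell's 2 remaining named inputs (hLiu418, h413) until rung 0 closes; this file is an ASSEMBLY over ★ material and asserts nothing printed.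

THE MATHEMATICS.  For a type-(2) `γ_H = (g, u)` at a non-split `w ∣ v` which is DEEP — `g_w ≡ 1`, `u_w ≡ 1 (mod c_w)` entrywise, `|c_w| = exp(−1)`, `σ(c) = c` — with
`|disc χ_g|_w = exp(−(2N+1))`, `N ≥ 1`, `|χ_g(u)|_w = exp(−n)`, `n ≥ 2`, `χ_{g_w}` without root, and `θ ∈ E_v` with `θ + σθ = 1`, `|θ_w| ≤ 1`: (§1) the hermitian Möbius denominators
`det((c−σθ)g + σθ)`, `det(θg + (c−θ))`, `(c−σθ)u + σθ`, `θu + (c−θ)`, `det((c−σθ)ι(γ_H) + σθ)` are UNITS of `E_v` (★ P2∕P3: their `w`-components have valuation `exp(−2)`, `exp(−1)`,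
`exp(−3)` — the cofactors `θ − (c−θ)X`, `σθ + (c−σθ)σX` of a residually skew-hermitian `X` are unimodular because `θ + σθ = 1`, where ★ γ₁ used `|2| = 1`); (§2) for any `γ_H′` with
`g′ = φ_θ(g) = (θg + (c−θ))((c−σθ)g + σθ)⁻¹`, `u′ = φ_θ(u)`: `|disc χ_{g′}|_w = exp(−(2(N−1)+1))`, `|χ_{g′}(u′)|_w = exp(−(n−2))` (the key scalar `θσθ − (c−θ)(c−σθ) = c(1−c)` has
valuation `|c|`), `χ_{g′_w}` has no root (`c(1−c) ≠ 0`), and `γ_H′` is `G`-regular (★ γ₃ §1: separability over `E_v` is read at `w`).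

## References
* [Rogawski1990] J. D. Rogawski, *Automorphic Representations of Unitary Groups in Three Variables*, Ann. of Math. Stud. 123 (1990), §4.9 Prop. 4.9.1 (b) p. 55; §4.3 p. 42.
* [Kottwitz1986BaseChangeUnits] R. E. Kottwitz, *Base change for unit elements of Hecke algebras*, Compositio Math. 60 (1986), §2 pp. 244–247.
* [Flicker1998UnitaryFL] Y. Z. Flicker, *Elementary proof of the fundamental lemma for a unitary group*, Canad. J. Math. 50 (1998), §6.
-/

set_option autoImplicit false

noncomputable section

open NumberField IsDedekindDomain Matrix Polynomial
open scoped MatrixGroups WithZero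

namespace Literature.NumberTheory.Rogawski1990

open Literature.NumberTheory.Automorphic Literature.NumberTheory.Automorphic.UnitaryGroup Literature.NumberTheory.Automorphic.MoebiusShift
open Literature.NumberTheory.GaloisRepresentations Literature.NumberTheory.NumberFields

variable (L : Type) [Field L] [NumberField L] [IsCMField L] (v : HeightOneSpectrum (𝓞 ↥(maximalRealSubfield L)))
  (w : PlacesOver L v) (hw : IsCMField.complexConj L • w.1 = w.1)

/-! ## §1 The hermitian Möbius denominators of a deep type-(2) `γ_H` are units of `E_v` -/

include hw in
/-- **THE HERMITIAN DENOMINATORS ARE UNITS** (and the `w`-facts they come from): for a deep type-(2) `γ_H = (g, u)` at a non-split `w` and `θ + σθ = 1`, `|θ_w| ≤ 1` (hypotheses as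
in the module docstring; NO `|2|_w = 1`), `det((c−σθ)g + σθ)`, `det(θg + (c−θ))`, `(c−σθ)u + σθ`, `θu + (c−θ)` and `det((c−σθ)ι(γ_H) + σθ)` are units of `E_v`, with `w`-valuations
`exp(−2), exp(−2), exp(−1), exp(−1)` for the first four (★ P3 `valued_hermitianShift_denominators_of_unitary_of_exp`; θ-twin of ★ γ₃ `isUnit_shift_denominators_of_typeTwo`).
[cite: Kottwitz1986BaseChangeUnits, §2 pp. 244–247] [cite: Rogawski1990, §4.9 Prop. 4.9.1 (b) p. 55] -/
theorem isUnit_hermitianShift_denominators_of_typeTwo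
    (γH : (cmDatum L 2 (Matrix.of fun i j : Fin 2 => if i.val + j.val + 1 = 2 then (1 : L) else 0)).Local v ×
      (cmDatum L 1 (Matrix.of fun i j : Fin 1 => if i.val + j.val + 1 = 1 then (1 : L) else 0)).Local v)
    {c : LocalRing L v} (hσc : conjLocal L (IsCMField.complexConj L) v c = c) (hc : Valued.v (c w) = WithZero.exp (-1 : ℤ))
    (θ : LocalRing L v) (hθ : θ + conjLocal L (IsCMField.complexConj L) v θ = 1) (hθv : Valued.v (θ w) ≤ 1)
    (hg1 : ∀ i j, Valued.v ((((γH.1.val : GL (Fin 2) (LocalRing L v)).val.map (Pi.evalRingHom (fun w' : PlacesOver L v => w'.1.adicCompletion L) w)) - 1) i j) ≤ Valued.v (c w))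
    (hu1 : Valued.v (finGammaTwo L v γH w - 1) ≤ Valued.v (c w))
    {N : ℕ} (hN1 : 1 ≤ N)
    (hN : Valued.v (((γH.1.val : GL (Fin 2) (LocalRing L v)).val.map
        (Pi.evalRingHom (fun w' : PlacesOver L v => w'.1.adicCompletion L) w)).trace ^ 2 -
      4 * ((γH.1.val : GL (Fin 2) (LocalRing L v)).val.map
        (Pi.evalRingHom (fun w' : PlacesOver L v => w'.1.adicCompletion L) w)).det) = WithZero.exp (-((2 * N + 1 : ℕ) : ℤ))) :
    Valued.v ((((c - conjLocal L (IsCMField.complexConj L) v θ) • ((γH.1.val : GL (Fin 2) (LocalRing L v)).val : Matrix (Fin 2) (Fin 2) (LocalRing L v)) +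
        conjLocal L (IsCMField.complexConj L) v θ • (1 : Matrix (Fin 2) (Fin 2) (LocalRing L v))).det) w) = WithZero.exp (-2 : ℤ) ∧
      Valued.v (((θ • ((γH.1.val : GL (Fin 2) (LocalRing L v)).val : Matrix (Fin 2) (Fin 2) (LocalRing L v)) + (c - θ) • (1 : Matrix (Fin 2) (Fin 2) (LocalRing L v))).det) w) =
        WithZero.exp (-2 : ℤ) ∧
      Valued.v (((c - conjLocal L (IsCMField.complexConj L) v θ) * finGammaTwo L v γH + conjLocal L (IsCMField.complexConj L) v θ) w) = WithZero.exp (-1 : ℤ) ∧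
      Valued.v ((θ * finGammaTwo L v γH + (c - θ)) w) = WithZero.exp (-1 : ℤ) ∧
      IsUnit ((((c - conjLocal L (IsCMField.complexConj L) v θ) • ((γH.1.val : GL (Fin 2) (LocalRing L v)).val : Matrix (Fin 2) (Fin 2) (LocalRing L v)) +
        conjLocal L (IsCMField.complexConj L) v θ • (1 : Matrix (Fin 2) (Fin 2) (LocalRing L v))).det)) ∧
      IsUnit (((θ • ((γH.1.val : GL (Fin 2) (LocalRing L v)).val : Matrix (Fin 2) (Fin 2) (LocalRing L v)) + (c - θ) • (1 : Matrix (Fin 2) (Fin 2) (LocalRing L v))).det)) ∧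
      IsUnit ((c - conjLocal L (IsCMField.complexConj L) v θ) * finGammaTwo L v γH + conjLocal L (IsCMField.complexConj L) v θ) ∧
      IsUnit (θ * finGammaTwo L v γH + (c - θ)) ∧
      IsUnit ((((c - conjLocal L (IsCMField.complexConj L) v θ) • ((γH.2.val : GL (Fin 1) (LocalRing L v)).val : Matrix (Fin 1) (Fin 1) (LocalRing L v)) +
        conjLocal L (IsCMField.complexConj L) v θ • (1 : Matrix (Fin 1) (Fin 1) (LocalRing L v))).det)) ∧
      IsUnit (((θ • ((γH.2.val : GL (Fin 1) (LocalRing L v)).val : Matrix (Fin 1) (Fin 1) (LocalRing L v)) + (c - θ) • (1 : Matrix (Fin 1) (Fin 1) (LocalRing L v))).det)) ∧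
      IsUnit (((c - conjLocal L (IsCMField.complexConj L) v θ) • (((endoEmbLocal L v γH).val : GL (Fin 3) (LocalRing L v)).val : Matrix (Fin 3) (Fin 3) (LocalRing L v)) +
        conjLocal L (IsCMField.complexConj L) v θ • (1 : Matrix (Fin 3) (Fin 3) (LocalRing L v))).det) := by
  have hv : Subsingleton (PlacesOver L v) := PlacesOver.subsingleton_of_smul_eq (IsCMField.complexConj L) (IsCMField.complexConj_ne_one L) w hw
  set evw : LocalRing L v →+* w.1.adicCompletion L := Pi.evalRingHom (fun w' : PlacesOver L v => w'.1.adicCompletion L) w with hevw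
  set σw := galAdicCompletionMap (L := L) (IsCMField.complexConj L) hw with hσw
  set gw : Matrix (Fin 2) (Fin 2) (w.1.adicCompletion L) := ((γH.1.val : GL (Fin 2) (LocalRing L v)).val.map evw) with hgw
  set uw : w.1.adicCompletion L := finGammaTwo L v γH w with huw
  set cw : w.1.adicCompletion L := c w with hcw
  obtain ⟨hc0, hc1, -, -, -, -⟩ := shift_parameter_facts hc
  have hσ : ∀ x, Valued.v (σw x) = Valued.v x := fun x => valued_galAdicCompletionMap (L := L) (IsCMField.complexConj L) hw x
  have hσcw : σw cw = cw := by
    have h := congrFun hσc w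
    rw [conjLocal_apply_eq_of_smul_eq (IsCMField.complexConj L) (IsCMField.complexConj_ne_one L) v w hw] at h
    exact h
  -- the hermitian parameter at `w`: `θ_w + σ_w θ_w = 1`
  have hSθ : (conjLocal L (IsCMField.complexConj L) v θ) w = σw (θ w) :=
    conjLocal_apply_eq_of_smul_eq (IsCMField.complexConj L) (IsCMField.complexConj_ne_one L) v w hw θ
  have hθw : θ w + σw (θ w) = 1 := by
    have h := congrFun hθ w
    rw [Pi.add_apply, hSθ, Pi.one_apply] at h
    exact h
  -- the `U(Φ₂)`-coordinate: `g_w = 1 + c_w X`, unitary for `J = antidiag(1, 1)`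
  set X : Matrix (Fin 2) (Fin 2) (w.1.adicCompletion L) := cw⁻¹ • (gw - 1) with hX
  have hgX : gw = 1 + cw • X := eq_one_add_smul_inv_smul_sub_one hc0 gw
  have hXi : ∀ i j, Valued.v (X i j) ≤ 1 := forall_valued_inv_smul_sub_one_le_one hc0 hg1
  have hunit : (((1 : Matrix (Fin 2) (Fin 2) (w.1.adicCompletion L)) + cw • X).map σw)ᵀ * !![(0 : w.1.adicCompletion L), 1; 1, 0] * ((1 : Matrix (Fin 2) (Fin 2) _) + cw • X) =
      !![(0 : w.1.adicCompletion L), 1; 1, 0] := by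
    have h := transpose_map_fst_evalRingHom_mul L v w hw γH
    rw [placeForm_antidiagTwo_eq] at h
    rw [← hgX]
    exact h
  have hJ : ∀ i j, Valued.v (!![(0 : w.1.adicCompletion L), 1; 1, 0] i j) ≤ 1 := by
    intro i j; fin_cases i <;> fin_cases j <;> simp
  have hJd : Valued.v (!![(0 : w.1.adicCompletion L), 1; 1, 0]).det = 1 := by
    rw [Matrix.det_fin_two_of, zero_mul, zero_sub, mul_one, Valuation.map_neg, map_one]
  have hN' : Valued.v (((1 : Matrix (Fin 2) (Fin 2) (w.1.adicCompletion L)) + cw • X).trace ^ 2 - 4 * ((1 : Matrix (Fin 2) (Fin 2) _) + cw • X).det) =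
      WithZero.exp (-((2 * N + 1 : ℕ) : ℤ)) := by rw [← hgX]; exact hN
  have e2 : Valued.v cw ^ 2 = WithZero.exp (-2 : ℤ) := by rw [hc, ← WithZero.exp_nsmul]; norm_num
  have hdisc : Valued.v (X.trace ^ 2 - 4 * X.det) < 1 := by
    refine (valued_disc_lt_one_iff_of_valued_lt_one hc0 X).2 ?_
    rw [hN', e2, WithZero.exp_lt_exp]
    omega
  -- the `U(Φ₁)`-coordinate: `u_w = 1 + c_w y`, of norm one
  set y : w.1.adicCompletion L := cw⁻¹ * (uw - 1) with hy
  have huy : uw = 1 + cw * y := by rw [hy, ← mul_assoc, mul_inv_cancel₀ hc0, one_mul, add_sub_cancel]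
  have hyi : Valued.v y ≤ 1 := valued_inv_mul_sub_one_le_one hc0 hu1
  have hnorm : σw (1 + cw * y) * (1 + cw * y) = 1 := by rw [← huy]; exact map_finGammaTwo_mul_finGammaTwo L v w hw γH
  -- ★ P3: the four hermitian denominators at `w`
  obtain ⟨hDm, hDp, hum, hup⟩ := valued_hermitianShift_denominators_of_unitary_of_exp σw hσ hθv hθw hJ hJd hc hσcw hXi hdisc hunit hyi hnorm
  rw [← hgX] at hDm hDp
  rw [← huy] at hum hup
  -- reading the `E_v`-elements at `w`
  have hdet2 : ∀ a b : LocalRing L v, ((a • ((γH.1.val : GL (Fin 2) (LocalRing L v)).val : Matrix (Fin 2) (Fin 2) (LocalRing L v)) + b • (1 : Matrix (Fin 2) (Fin 2) (LocalRing L v))).det) w =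
      (a w • gw + b w • (1 : Matrix (Fin 2) (Fin 2) (w.1.adicCompletion L))).det := fun a b => by
    have e1 : ((a • ((γH.1.val : GL (Fin 2) (LocalRing L v)).val : Matrix (Fin 2) (Fin 2) (LocalRing L v)) + b • (1 : Matrix (Fin 2) (Fin 2) (LocalRing L v))).det) w =
        evw ((a • ((γH.1.val : GL (Fin 2) (LocalRing L v)).val : Matrix (Fin 2) (Fin 2) (LocalRing L v)) + b • (1 : Matrix (Fin 2) (Fin 2) (LocalRing L v))).det) := rfl
    rw [e1, RingHom.map_det, RingHom.mapMatrix_apply, map_smul_add_smul_one]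
    rfl
  have hdet1 : ∀ a b : LocalRing L v, ((a • ((γH.2.val : GL (Fin 1) (LocalRing L v)).val : Matrix (Fin 1) (Fin 1) (LocalRing L v)) + b • (1 : Matrix (Fin 1) (Fin 1) (LocalRing L v))).det) w =
      a w * uw + b w := fun a b => by
    have e1 : ((a • ((γH.2.val : GL (Fin 1) (LocalRing L v)).val : Matrix (Fin 1) (Fin 1) (LocalRing L v)) + b • (1 : Matrix (Fin 1) (Fin 1) (LocalRing L v))).det) w =
        evw ((a • ((γH.2.val : GL (Fin 1) (LocalRing L v)).val : Matrix (Fin 1) (Fin 1) (LocalRing L v)) + b • (1 : Matrix (Fin 1) (Fin 1) (LocalRing L v))).det) := rfl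
    rw [e1, Matrix.det_fin_one]
    simp [evw, uw, finGammaTwo]
  have hsc : ∀ a b : LocalRing L v, ((a * finGammaTwo L v γH + b) w) = a w * uw + b w := fun a b => rfl
  have hSm : (c - conjLocal L (IsCMField.complexConj L) v θ) w = cw - σw (θ w) := by rw [Pi.sub_apply, hSθ]
  have hw2m : Valued.v ((((c - conjLocal L (IsCMField.complexConj L) v θ) • ((γH.1.val : GL (Fin 2) (LocalRing L v)).val : Matrix (Fin 2) (Fin 2) (LocalRing L v)) +
      conjLocal L (IsCMField.complexConj L) v θ • (1 : Matrix (Fin 2) (Fin 2) (LocalRing L v))).det) w) = WithZero.exp (-2 : ℤ) := by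
    rw [hdet2, hSm, hSθ]; exact hDm
  have hw2p : Valued.v (((θ • ((γH.1.val : GL (Fin 2) (LocalRing L v)).val : Matrix (Fin 2) (Fin 2) (LocalRing L v)) + (c - θ) • (1 : Matrix (Fin 2) (Fin 2) (LocalRing L v))).det) w) =
      WithZero.exp (-2 : ℤ) := by rw [hdet2]; exact hDp
  have hw1m : Valued.v (((c - conjLocal L (IsCMField.complexConj L) v θ) * finGammaTwo L v γH + conjLocal L (IsCMField.complexConj L) v θ) w) = WithZero.exp (-1 : ℤ) := by
    rw [hsc, hSm, hSθ]; exact hum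
  have hw1p : Valued.v ((θ * finGammaTwo L v γH + (c - θ)) w) = WithZero.exp (-1 : ℤ) := by rw [hsc]; exact hup
  have hne : ∀ {x : LocalRing L v} {z : ℤ}, Valued.v (x w) = WithZero.exp z → IsUnit x := fun {x z} hx =>
    isUnit_localRing_of_ne_zero_of_subsingleton L v hv fun h0 => by rw [h0, Pi.zero_apply, map_zero] at hx; exact WithZero.zero_ne_coe hx
  have hU2m := hne hw2m
  have hU2p := hne hw2p
  have hU1m := hne hw1m
  have hU1p := hne hw1p
  have hU1m' : IsUnit ((((c - conjLocal L (IsCMField.complexConj L) v θ) • ((γH.2.val : GL (Fin 1) (LocalRing L v)).val : Matrix (Fin 1) (Fin 1) (LocalRing L v)) +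
      conjLocal L (IsCMField.complexConj L) v θ • (1 : Matrix (Fin 1) (Fin 1) (LocalRing L v))).det)) :=
    hne (z := -1) (by rw [hdet1, hSm, hSθ]; exact hum)
  have hU1p' : IsUnit (((θ • ((γH.2.val : GL (Fin 1) (LocalRing L v)).val : Matrix (Fin 1) (Fin 1) (LocalRing L v)) + (c - θ) • (1 : Matrix (Fin 1) (Fin 1) (LocalRing L v))).det)) :=
    hne (z := -1) (by rw [hdet1]; exact hup)
  refine ⟨hw2m, hw2p, hw1m, hw1p, hU2m, hU2p, hU1m, hU1p, hU1m', hU1p', ?_⟩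
  -- the `3 × 3` denominator of `ι(γ_H)`: block diagonal
  have e3 : (c - conjLocal L (IsCMField.complexConj L) v θ) • (((endoEmbLocal L v γH).val : GL (Fin 3) (LocalRing L v)).val : Matrix (Fin 3) (Fin 3) (LocalRing L v)) +
        conjLocal L (IsCMField.complexConj L) v θ • (1 : Matrix (Fin 3) (Fin 3) (LocalRing L v)) =
      Matrix.reindex endoPerm endoPerm (Matrix.fromBlocks
        ((c - conjLocal L (IsCMField.complexConj L) v θ) • ((γH.1.val : GL (Fin 2) (LocalRing L v)).val : Matrix (Fin 2) (Fin 2) (LocalRing L v)) +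
          conjLocal L (IsCMField.complexConj L) v θ • (1 : Matrix (Fin 2) (Fin 2) (LocalRing L v))) 0 0
        ((c - conjLocal L (IsCMField.complexConj L) v θ) • ((γH.2.val : GL (Fin 1) (LocalRing L v)).val : Matrix (Fin 1) (Fin 1) (LocalRing L v)) +
          conjLocal L (IsCMField.complexConj L) v θ • (1 : Matrix (Fin 1) (Fin 1) (LocalRing L v)))) := by
    rw [coe_endoEmbLocal, coe_endoGL, smul_reindex_add_smul_one, smul_fromBlocks_add_smul_one]
  rw [e3, Matrix.det_reindex_self, Matrix.det_fromBlocks_zero₁₂]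
  exact hU2m.mul hU1m'

/-! ## §2 The ★ value theorems' binders for the hermitian-shifted `γ_H′` at `(n − 2, N − 1)` -/

include hw in
/-- **THE HERMITIAN-SHIFTED BINDERS**: for a deep type-(2) `γ_H` (as in `isUnit_hermitianShift_denominators_of_typeTwo`, plus `|χ_g(u)|_w = exp(−n)`, `n ≥ 2`, `χ_{g_w}` rootless), `θ + σθ = 1`
with `|θ_w| ≤ 1`, and any `γ_H′` on the carriers with `g′ = φ_θ(g) = (θg + (c−θ))((c−σθ)g + σθ)⁻¹`, `u′ = φ_θ(u)` as matrices: `|disc χ_{g′}|_w = exp(−(2(N−1)+1))`,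
`|χ_{g′}(u′)|_w = exp(−(n−2))`, `χ_{g′_w}` has no root in `L_w`, and `γ_H′` is `G`-regular (★ P3 dictionary; `φ_θ` commutes with `(·)_w`, ★ `map_genMoebius`; key scalar
`θσθ − (c−θ)(c−σθ) = c(1−c) ≠ 0`; θ-twin of ★ γ₃ `shifted_binders_of_typeTwo`, NO `|2|_w = 1`). [cite: Flicker1998UnitaryFL, §6] [cite: Kottwitz1986BaseChangeUnits, §2 pp. 244–247]
[cite: Rogawski1990, §4.9 Prop. 4.9.1 (b) p. 55; §4.3 p. 42] -/
theorem hermitianShifted_binders_of_typeTwo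
    (γH γH' : (cmDatum L 2 (Matrix.of fun i j : Fin 2 => if i.val + j.val + 1 = 2 then (1 : L) else 0)).Local v ×
      (cmDatum L 1 (Matrix.of fun i j : Fin 1 => if i.val + j.val + 1 = 1 then (1 : L) else 0)).Local v)
    {c : LocalRing L v} (hσc : conjLocal L (IsCMField.complexConj L) v c = c) (hc : Valued.v (c w) = WithZero.exp (-1 : ℤ))
    (θ : LocalRing L v) (hθ : θ + conjLocal L (IsCMField.complexConj L) v θ = 1) (hθv : Valued.v (θ w) ≤ 1)
    (h1 : ((γH'.1.val : GL (Fin 2) (LocalRing L v)).val : Matrix (Fin 2) (Fin 2) (LocalRing L v)) =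
      (θ • ((γH.1.val : GL (Fin 2) (LocalRing L v)).val : Matrix (Fin 2) (Fin 2) (LocalRing L v)) + (c - θ) • 1) *
        ((c - conjLocal L (IsCMField.complexConj L) v θ) • ((γH.1.val : GL (Fin 2) (LocalRing L v)).val : Matrix (Fin 2) (Fin 2) (LocalRing L v)) +
          conjLocal L (IsCMField.complexConj L) v θ • 1)⁻¹)
    (hu' : finGammaTwo L v γH' = (θ * finGammaTwo L v γH + (c - θ)) *
      Ring.inverse ((c - conjLocal L (IsCMField.complexConj L) v θ) * finGammaTwo L v γH + conjLocal L (IsCMField.complexConj L) v θ))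
    (hg1 : ∀ i j, Valued.v ((((γH.1.val : GL (Fin 2) (LocalRing L v)).val.map (Pi.evalRingHom (fun w' : PlacesOver L v => w'.1.adicCompletion L) w)) - 1) i j) ≤ Valued.v (c w))
    (hu1 : Valued.v (finGammaTwo L v γH w - 1) ≤ Valued.v (c w))
    (hirr : ¬ ∃ x : w.1.adicCompletion L, (((γH.1.val : GL (Fin 2) (LocalRing L v)).val.map
        (Pi.evalRingHom (fun w' : PlacesOver L v => w'.1.adicCompletion L) w)).charpoly).IsRoot x)
    {n N : ℕ} (hn2 : 2 ≤ n) (hN1 : 1 ≤ N)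
    (hn : Valued.v (((finCharpolyTwo L v γH).eval (finGammaTwo L v γH)) w) = WithZero.exp (-(n : ℤ)))
    (hN : Valued.v (((γH.1.val : GL (Fin 2) (LocalRing L v)).val.map
        (Pi.evalRingHom (fun w' : PlacesOver L v => w'.1.adicCompletion L) w)).trace ^ 2 -
      4 * ((γH.1.val : GL (Fin 2) (LocalRing L v)).val.map
        (Pi.evalRingHom (fun w' : PlacesOver L v => w'.1.adicCompletion L) w)).det) = WithZero.exp (-((2 * N + 1 : ℕ) : ℤ))) :
    Valued.v (((γH'.1.val : GL (Fin 2) (LocalRing L v)).val.map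
        (Pi.evalRingHom (fun w' : PlacesOver L v => w'.1.adicCompletion L) w)).trace ^ 2 -
      4 * ((γH'.1.val : GL (Fin 2) (LocalRing L v)).val.map
        (Pi.evalRingHom (fun w' : PlacesOver L v => w'.1.adicCompletion L) w)).det) = WithZero.exp (-((2 * (N - 1) + 1 : ℕ) : ℤ)) ∧
    Valued.v (((finCharpolyTwo L v γH').eval (finGammaTwo L v γH')) w) = WithZero.exp (-((n - 2 : ℕ) : ℤ)) ∧
    (¬ ∃ x : w.1.adicCompletion L, (((γH'.1.val : GL (Fin 2) (LocalRing L v)).val.map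
        (Pi.evalRingHom (fun w' : PlacesOver L v => w'.1.adicCompletion L) w)).charpoly).IsRoot x) ∧
    IsLocalGRegular L v γH' := by
  have hv : Subsingleton (PlacesOver L v) := PlacesOver.subsingleton_of_smul_eq (IsCMField.complexConj L) (IsCMField.complexConj_ne_one L) w hw
  obtain ⟨hw2m, -, hw1m, -, hU2m, -, hU1m, -, -, -, -⟩ := isUnit_hermitianShift_denominators_of_typeTwo L v w hw γH hσc hc θ hθ hθv hg1 hu1 hN1 hN
  set evw : LocalRing L v →+* w.1.adicCompletion L := Pi.evalRingHom (fun w' : PlacesOver L v => w'.1.adicCompletion L) w with hevw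
  set σw := galAdicCompletionMap (L := L) (IsCMField.complexConj L) hw with hσw
  set gw : Matrix (Fin 2) (Fin 2) (w.1.adicCompletion L) := ((γH.1.val : GL (Fin 2) (LocalRing L v)).val.map evw) with hgw
  set uw : w.1.adicCompletion L := finGammaTwo L v γH w with huw
  set cw : w.1.adicCompletion L := c w with hcw
  obtain ⟨hc0, hc1, -, -, -, -⟩ := shift_parameter_facts hc
  -- characteristic zero: `2 ≠ 0` in `L_w` (no valuation hypothesis on `2` is used anywhere)
  haveI : CharZero (w.1.adicCompletion L) := charZero_of_injective_algebraMap (algebraMap L (w.1.adicCompletion L)).injective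
  haveI : NeZero (2 : w.1.adicCompletion L) := ⟨two_ne_zero⟩
  -- the hermitian parameter at `w`
  have hSθ : evw (conjLocal L (IsCMField.complexConj L) v θ) = σw (θ w) :=
    conjLocal_apply_eq_of_smul_eq (IsCMField.complexConj L) (IsCMField.complexConj_ne_one L) v w hw θ
  have hθw : θ w + σw (θ w) = 1 := by
    have h := congrFun hθ w
    rw [Pi.add_apply, Pi.one_apply] at h
    rw [← hSθ]; exact h
  -- `g′_w = φ_θ(g_w)` and `u′_w = φ_θ(u_w)`
  have hg'w : ((γH'.1.val : GL (Fin 2) (LocalRing L v)).val.map evw) =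
      (θ w • gw + (cw - θ w) • (1 : Matrix (Fin 2) (Fin 2) (w.1.adicCompletion L))) *
        ((cw - σw (θ w)) • gw + σw (θ w) • (1 : Matrix (Fin 2) (Fin 2) (w.1.adicCompletion L)))⁻¹ := by
    rw [h1, map_genMoebius evw _ _ _ _ _ hU2m, map_sub, map_sub, hSθ]
    rfl
  have hD2w : Valued.v (((cw - σw (θ w)) • gw + σw (θ w) • (1 : Matrix (Fin 2) (Fin 2) (w.1.adicCompletion L))).det) = WithZero.exp (-2 : ℤ) := by
    have e1 : (((c - conjLocal L (IsCMField.complexConj L) v θ) • ((γH.1.val : GL (Fin 2) (LocalRing L v)).val : Matrix (Fin 2) (Fin 2) (LocalRing L v)) +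
        conjLocal L (IsCMField.complexConj L) v θ • (1 : Matrix (Fin 2) (Fin 2) (LocalRing L v))).det) w =
        evw (((c - conjLocal L (IsCMField.complexConj L) v θ) • ((γH.1.val : GL (Fin 2) (LocalRing L v)).val : Matrix (Fin 2) (Fin 2) (LocalRing L v)) +
        conjLocal L (IsCMField.complexConj L) v θ • (1 : Matrix (Fin 2) (Fin 2) (LocalRing L v))).det) := rfl
    have e : (((c - conjLocal L (IsCMField.complexConj L) v θ) • ((γH.1.val : GL (Fin 2) (LocalRing L v)).val : Matrix (Fin 2) (Fin 2) (LocalRing L v)) +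
        conjLocal L (IsCMField.complexConj L) v θ • (1 : Matrix (Fin 2) (Fin 2) (LocalRing L v))).det) w =
        (((cw - σw (θ w)) • gw + σw (θ w) • (1 : Matrix (Fin 2) (Fin 2) (w.1.adicCompletion L))).det) := by
      rw [e1, RingHom.map_det, RingHom.mapMatrix_apply, map_smul_add_smul_one, map_sub, hSθ]
      rfl
    rw [← e]; exact hw2m
  have hscw : ((c - conjLocal L (IsCMField.complexConj L) v θ) * finGammaTwo L v γH + conjLocal L (IsCMField.complexConj L) v θ) w = (cw - σw (θ w)) * uw + σw (θ w) := by
    show evw ((c - conjLocal L (IsCMField.complexConj L) v θ) * finGammaTwo L v γH + conjLocal L (IsCMField.complexConj L) v θ) = _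
    rw [map_add, map_mul, map_sub, hSθ]
    rfl
  have hw1m' : Valued.v ((cw - σw (θ w)) * uw + σw (θ w)) = WithZero.exp (-1 : ℤ) := by rw [← hscw]; exact hw1m
  have huw' : finGammaTwo L v γH' w = (θ w * uw + (cw - θ w)) / ((cw - σw (θ w)) * uw + σw (θ w)) := by
    have hmul : finGammaTwo L v γH' * ((c - conjLocal L (IsCMField.complexConj L) v θ) * finGammaTwo L v γH + conjLocal L (IsCMField.complexConj L) v θ) =
        θ * finGammaTwo L v γH + (c - θ) := by
      rw [hu', mul_assoc, Ring.inverse_mul_cancel _ hU1m, mul_one]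
    have hmw := congrFun hmul w
    rw [Pi.mul_apply, hscw] at hmw
    have hne : (cw - σw (θ w)) * uw + σw (θ w) ≠ 0 := fun h => by
      rw [h, map_zero] at hw1m'; exact WithZero.zero_ne_coe hw1m'
    rw [eq_div_iff hne, hmw]
    rfl
  -- (1) the discriminant
  have hN' := valued_disc_hermitianMoebius_of_exp σw hθw hc gw hD2w hN1 hN
  rw [← hg'w] at hN'
  -- (2) the value `χ_{g′}(u′)`
  have hev : ∀ (γ : (cmDatum L 2 (Matrix.of fun i j : Fin 2 => if i.val + j.val + 1 = 2 then (1 : L) else 0)).Local v ×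
      (cmDatum L 1 (Matrix.of fun i j : Fin 1 => if i.val + j.val + 1 = 1 then (1 : L) else 0)).Local v),
      ((finCharpolyTwo L v γ).eval (finGammaTwo L v γ)) w = (((γ.1.val : GL (Fin 2) (LocalRing L v)).val.map evw).charpoly).eval (finGammaTwo L v γ w) := fun γ => by
    have e : ((finCharpolyTwo L v γ).eval (finGammaTwo L v γ)) w = evw ((finCharpolyTwo L v γ).eval (finGammaTwo L v γ)) := rfl
    rw [e, ← Polynomial.eval₂_at_apply, ← Polynomial.eval_map, finCharpolyTwo, ← Matrix.charpoly_map]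
    rfl
  have hnw : Valued.v (gw.charpoly.eval uw) = WithZero.exp (-(n : ℤ)) := by rw [hgw, huw, ← hev]; exact hn
  have hn' := valued_eval_charpoly_hermitianMoebius_of_exp σw hθw hc gw uw hD2w hw1m' hn2 hnw
  rw [← hg'w, ← huw'] at hn'
  rw [← hev] at hn'
  -- (3) no root: the key scalar `θσθ − (c−θ)(c−σθ) = c(1−c)` is non-zero
  have hD0 : ((cw - σw (θ w)) • gw + σw (θ w) • (1 : Matrix (Fin 2) (Fin 2) (w.1.adicCompletion L))).det ≠ 0 := fun h => by
    rw [h, map_zero] at hD2w; exact WithZero.zero_ne_coe hD2w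
  have hc1' : (1 : w.1.adicCompletion L) - cw ≠ 0 := fun h => by
    rw [sub_eq_zero] at h
    rw [← h, map_one] at hc1
    exact lt_irrefl _ hc1
  have hΔ : θ w * σw (θ w) - (cw - θ w) * (cw - σw (θ w)) ≠ 0 := by
    rw [hermitianPair_key_scalar σw hθw cw]
    exact mul_ne_zero hc0 hc1'
  have hirr' := not_exists_isRoot_charpoly_genMoebius gw (θ w) (cw - θ w) (σw (θ w)) (cw - σw (θ w)) hD0 hΔ hirr
  rw [← hg'w] at hirr'
  -- (4) `G`-regularity: separability at `w`, lifted to `E_v` (verbatim ★ γ₃)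
  have hdisc' : ((γH'.1.val : GL (Fin 2) (LocalRing L v)).val.map evw).trace ^ 2 - 4 * ((γH'.1.val : GL (Fin 2) (LocalRing L v)).val.map evw).det ≠ 0 := fun h => by
    rw [h, map_zero] at hN'; exact WithZero.zero_ne_coe hN'
  have hval' : (((γH'.1.val : GL (Fin 2) (LocalRing L v)).val.map evw).charpoly).eval (finGammaTwo L v γH' w) ≠ 0 := fun h => by
    rw [hev, h, map_zero] at hn'; exact WithZero.zero_ne_coe hn'
  have hsepw := separable_charpoly_mul_X_sub_C _ _ hdisc' hval'
  have hreg' : IsLocalGRegular L v γH' := by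
    have hgoal : (((γH'.1.val : GL (Fin 2) (LocalRing L v)).val : Matrix (Fin 2) (Fin 2) (LocalRing L v)).charpoly *
        ((γH'.2.val : GL (Fin 1) (LocalRing L v)).val : Matrix (Fin 1) (Fin 1) (LocalRing L v)).charpoly).Separable := by
      refine separable_of_map_evalRingHom L v w hv _ ?_
      rw [Polynomial.map_mul, ← Matrix.charpoly_map, ← Matrix.charpoly_map]
      have hUc : (((γH'.2.val : GL (Fin 1) (LocalRing L v)).val : Matrix (Fin 1) (Fin 1) (LocalRing L v)).map evw).charpoly = X - C (finGammaTwo L v γH' w) := by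
        rw [Matrix.charpoly, Matrix.det_fin_one, Matrix.charmatrix_apply_eq, Matrix.map_apply]
        rfl
      rw [hUc]
      exact hsepw
    simp only [IsLocalGRegular, IsGRegular, IsRegularElt, coe_endoEmb, coe_endoGL, Matrix.charpoly_reindex, Matrix.charpoly_fromBlocks_zero₁₂]
    exact hgoal
  exact ⟨hN', hn', hirr', hreg'⟩

end Literature.NumberTheory.Rogawski1990

end
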